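import Summits.BirchSwinnertonDyer.Rank1Residual.Partition.MainConjecturesRankZeroFactsDerived
import Literature.NumberTheory.EllipticCurves.SkinnerUrban2014.PAdicUnitPeriodRatioProofs
import Literature.NumberTheory.EllipticCurves.SkinnerUrban2014.RankZeroPPartMazurProofs
import HarnessLib

/-!
# Row C1 (the Skinner–Urban route) at main-conjecture level with the period-unit inputs replaced by
# Mazur 1978, Cor. 4.1 (cell `b2b-bsdres`, literature typer `b2b-bsdres-lit-su`, gen 8; companion of
# `Partition/MainConjectures.lean` and `Partition/MainConjecturesRankZeroFactsDerived.lean`)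

HONEST FRAMING (cell `b2b-bsdres`, run/shared/lean/b2b/bsd-rank1-residual/, verbatim in every
file): the goal of the cell is to DELETE the COMBINATION-SHAPED residual classes of the
Birch–Swinnerton-Dyer formula for ALL analytic-rank `≤ 1` elliptic curves over `ℚ` — "full BSD
formula for every rank `≤ 1` curve in class `C`" assembled STRICTLY from published theorems — so
that the rank-`≤ 1` remainder becomes exactly the CONSTRUCTION-SHAPED classes, which are TYPED
(missing-input `Prop`s), NOT attempted. This is not "finishing BSD". Research routes; no claim
beyond the stated classes; nothing booked; no label changes. THEOREMS ONLY (no definition, no named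
fact, no `sorry`); every published theorem enters as one of the tree's existing named Literature
facts BY NAME.

## What this file records

The main-conjecture-level derivations of row C1 (`Partition/MainConjectures.lean`, gen 0;
`Partition/MainConjecturesRankZeroFactsDerived.lean`, GLUE gen 5 — the `…_of_ram` forms without
Wuthrich 2014 Lemma 20) carry the two period-unit binders
`(h5 : realPeriodRat_eq_unit_mul_plusPeriod) (h3 : realPeriodRat_eq_unit_mul_plusPeriod_three)`
("`Ω_E = u · Ω⁺_f`, `u ∈ ℚ`, `|u|_p = 1` at an odd good prime with `E[p]` irreducible"), whose
printed source is a REMARK without proof (Greenberg–Vatsal 2000, §3, Remark 3.4: "it is clear that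
the Néron periods of any isogenous curve differ from those of `E` by a `p`-adic unit"; Skinner–Urban
2014, §3.6.7, p. 45: "if `E[p]` is an irreducible `G_ℚ`-representation, then `L_E` is a `p`-adic unit
multiple of `𝓛_f`"). Both binders are THEOREMS over the tree from the single named fact
`mazur_not_dvd_maninConstant_of_odd` — Mazur, *Rational isogenies of prime degree*, Invent. Math. 44
(1978), Cor. 4.1, in lattice form (= (MK-1) of Česnavičius, Compositio 154 (2018), §1), a theorem
with two printed proofs — by `SkinnerUrban2014.realPeriodRat_eq_unit_mul_plusPeriod_of_mazur` /
`…_three_of_mazur` (`Literature/…/SkinnerUrban2014/PAdicUnitPeriodRatioProofs.lean`: a `ℚ`-isogeny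
of degree prime to `p` onto the lattice-optimal curve exists BECAUSE `E[p]` is irreducible; Néron
integrality of the scaling in both directions; Edixhoven's integrality; Mazur's `p ∤ c`).

This file is the append-only realisation for row C1: the same three theorems with `(h5) (h3)`
replaced by `(hM : mazur_not_dvd_maninConstant_of_odd)`. Consequence for the registry
(CITED-FACTS): on the Skinner–Urban route every main-conjecture-level input of row C1 is now a
NUMBERED THEOREM with a printed proof, entering by name — Skinner–Urban 2014 Thm. 3.6.9 (bsd.S21),
Skinner 2016 Thm. A, Greenberg 1999 Thm. 4.1, Mazur 1978 Cor. 4.1, Jones 1989 / Stein–Wuthrich 2013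
Thm. 6.1 (split and non-split), Greenberg–Stevens, the Modularity Theorem (analytic continuation;
modular parametrisation), Gross–Zagier–Kolyvagin — and no remark-grade input remains. No statement
of any existing theorem changes; the gen-0 / gen-5 forms stay (they are these theorems fed with two
more facts, cf. `periodUnit_of_mazur`).

References: [Mazur1978] Cor. 4.1; [Cesnavicius2018Manin] §1 (MK-1); [GreenbergVatsal2000] §3
Rem. 3.4; [SkinnerUrban2014] §3.6.7 (p. 45), Thm. 3.6.9 (p. 45), Thm. 3.6.11 (a) and its proof
(p. 46); [Skinner2016PacificMC] Thm. A, Thm. C, §2.5, §3.2–3.3; [GreenbergLNM1716] Thm. 4.1;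
[SteinWuthrich2013] Thm. 6.1; [Miller2011LMS] Def. 1.1; HOME/b2b-bsdres-lit-su/SU2014-TYPING.md
§13 (derivation) and §14 (this file); RESIDUAL-CASES.md §a.1 row C1.
-/

set_option autoImplicit false

noncomputable section

open scoped Classical MatrixGroups ModularForm

open CongruenceSubgroup WeierstrassCurve Literature.NumberTheory.EllipticCurves
  Literature.NumberTheory.EllipticCurves.ModularForms
  Literature.NumberTheory.EllipticCurves.Rank1Residual
  Literature.NumberTheory.EllipticCurves.Skinner2016
  Literature.NumberTheory.EllipticCurves.SteinWuthrich2013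
  Summit.BirchSwinnertonDyer.BirchSwinnertonDyer.Theorems.Rank1ResidualX1Defs

namespace Summit.BirchSwinnertonDyer.Rank1Residual

section Curve

variable {W : WeierstrassCurve ℚ} [W.IsElliptic] [W.IsGloballyMinimal] {p : ℕ} [Fact p.Prime]

/-! ### §1. The S–U route adapter with Mazur 1978 Cor. 4.1 in place of the period-unit facts -/

/-- **Skinner–Urban 2014 Thm. 3.6.9 (integral clause) ⇒ the typed `MazurMainConjecture W p` on
{`p ≥ 3` good ordinary, (irr), (ram)} — with Mazur 1978 Cor. 4.1 as the only input besides
bsd.S21.** GLUE gen 5's `mazurMainConjecture_of_skinnerUrban_of_ram` with its two period-unit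
binders `h5`, `h3` (Greenberg–Vatsal 2000 Rem. 3.4, a remark without proof) supplied by the
theorems `SkinnerUrban2014.realPeriodRat_eq_unit_mul_plusPeriod_of_mazur` /
`…_three_of_mazur` from `hM` (Mazur's corollary in lattice form). (irr) + (ram) ⇒ `ρ̄_{E,p^∞}`
onto (no Wuthrich L. 20); S–U clauses (1), (3); Néron normalisation by the period unit.
[cite: SkinnerUrban2014, Thm. 3.6.9 and §3.6.7 (p. 45)] [cite: Mazur1978, Cor. 4.1]
[cite: Serre1972, §2.4 Prop. 15; IV §3.4 Lemma 2] -/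
theorem mazurMainConjecture_of_skinnerUrban_of_mazur
    (hSU : ∀ (W : WeierstrassCurve ℚ) [W.IsElliptic] [W.IsGloballyMinimal] (p : ℕ) [Fact p.Prime]
      (κ : ZpExtension ℚ p) (γ : Field.absoluteGaloisGroup ℚ) (N : ℕ) [NeZero N]
      (f : CuspForm (Gamma0 N) 2),
      skinner_urban_main_conjecture W p (κ := κ) (γ := γ) (f := f))
    (hM : mazur_not_dvd_maninConstant_of_odd)
    (hp : 3 ≤ p) (hord : GoodOrd W p) (hirr : Irr W p) (hram : Ram W p) :
    MazurMainConjecture W p :=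
  mazurMainConjecture_of_skinnerUrban_of_ram hSU
    (SkinnerUrban2014.realPeriodRat_eq_unit_mul_plusPeriod_of_mazur hM)
    (SkinnerUrban2014.realPeriodRat_eq_unit_mul_plusPeriod_three_of_mazur hM) hp hord hirr hram

/-! ### §2. Row C1's citation of record and row C1 itself from numbered theorems only -/

/-- **Skinner 2016 Thm. C in its LITERAL typed form `Skinner2016.thmC_padicValRat_bsd_rank_zero`,
from main-conjecture-level NUMBERED THEOREMS only** — GLUE gen 5's
`RowC1.skinnerThmC_of_mainConjectures` (Skinner's printed proof, Pacific J. Math. 283 (2016)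
§3.2–3.3 / S–U p. 46, run in the kernel) with the period-unit binders `h5`, `h3` supplied from
Mazur 1978 Cor. 4.1 (`hM`). Inputs, each an existing named fact of the tree entering by name:
Skinner–Urban 2014 Thm. 3.6.9 (`hSU`, bsd.S21; good ordinary branch, integral via (irr) + (ram)),
Skinner 2016 Thm. A (`hA`; multiplicative branch), Greenberg 1999 Thm. 4.1 (`hGr`),
Jones 1989 / Stein–Wuthrich 2013 Thm. 6.1 (`hJs`, `hJn`), Greenberg–Stevens (`hGS`), Mazur 1978
Cor. 4.1 (`hM`), the Modularity Theorem (`hmod` analytic continuation, `hpar` modular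
parametrisation), Gross–Zagier–Kolyvagin (`hGZK`).
[cite: Skinner2016PacificMC, Thm. C, footnote 1, §2.5, Thm. A, §3.2–3.3]
[cite: SkinnerUrban2014, Thm. 3.6.9 (p. 45), proof of Thm. 3.6.11 (p. 46)]
[cite: GreenbergLNM1716, Thm. 4.1 (p. 102)] [cite: Mazur1978, Cor. 4.1]
[cite: SteinWuthrich2013, Thm. 6.1 (p. 20)] [cite: Miller2011LMS, §1 and Def. 1.1] -/
theorem RowC1.skinnerThmC_of_mainConjectures_of_mazur
    (hSU : ∀ (W : WeierstrassCurve ℚ) [W.IsElliptic] [W.IsGloballyMinimal] (p : ℕ) [Fact p.Prime]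
      (κ : ZpExtension ℚ p) (γ : Field.absoluteGaloisGroup ℚ) (N : ℕ) [NeZero N]
      (f : CuspForm (Gamma0 N) 2),
      skinner_urban_main_conjecture W p (κ := κ) (γ := γ) (f := f))
    (hA : thmA_charIdeal_multiplicative) (hGr : greenberg_charValue_rankZero)
    (hJs : thm61_splitMultiplicative) (hJn : thm61_nonsplitMultiplicative)
    (hGS : ∀ (W : WeierstrassCurve ℚ) [W.IsElliptic] [W.IsGloballyMinimal] (p : ℕ) [Fact p.Prime],
      greenberg_stevens (W := W) (p := p))
    (hM : mazur_not_dvd_maninConstant_of_odd)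
    (hmod : hasEntireLFunction_rat) (hpar : nonempty_modularParametrizationData)
    (hGZK : rank_eq_analyticRank_of_analyticRank_le_one) :
    Skinner2016.thmC_padicValRat_bsd_rank_zero :=
  RowC1.skinnerThmC_of_mainConjectures hSU hA hGr hJs hJn hGS
    (SkinnerUrban2014.realPeriodRat_eq_unit_mul_plusPeriod_of_mazur hM)
    (SkinnerUrban2014.realPeriodRat_eq_unit_mul_plusPeriod_three_of_mazur hM) hmod hpar hGZK

/-- **C1 at main-conjecture level from numbered theorems only**: `RowC1 W p ⟹ BSDp W p` with the
inputs of `RowC1.skinnerThmC_of_mainConjectures_of_mazur` — GLUE gen 5's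
`RowC1.bsdp_of_mainConjectures_of_ram` with `(h5) (h3)` replaced by Mazur 1978 Cor. 4.1 (`hM`).
[cite: Skinner2016PacificMC, Thm. C, Thm. A, §3.2–3.3] [cite: SkinnerUrban2014, Thm. 3.6.9 (p. 45)]
[cite: Mazur1978, Cor. 4.1] [cite: Miller2011LMS, Def. 1.1] -/
theorem RowC1.bsdp_of_mainConjectures_of_mazur
    (hSU : ∀ (W : WeierstrassCurve ℚ) [W.IsElliptic] [W.IsGloballyMinimal] (p : ℕ) [Fact p.Prime]
      (κ : ZpExtension ℚ p) (γ : Field.absoluteGaloisGroup ℚ) (N : ℕ) [NeZero N]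
      (f : CuspForm (Gamma0 N) 2),
      skinner_urban_main_conjecture W p (κ := κ) (γ := γ) (f := f))
    (hA : thmA_charIdeal_multiplicative) (hGr : greenberg_charValue_rankZero)
    (hJs : thm61_splitMultiplicative) (hJn : thm61_nonsplitMultiplicative)
    (hGS : ∀ (W : WeierstrassCurve ℚ) [W.IsElliptic] [W.IsGloballyMinimal] (p : ℕ) [Fact p.Prime],
      greenberg_stevens (W := W) (p := p))
    (hM : mazur_not_dvd_maninConstant_of_odd)
    (hmod : hasEntireLFunction_rat) (hpar : nonempty_modularParametrizationData)
    (hGZK : rank_eq_analyticRank_of_analyticRank_le_one) (h : RowC1 W p) : BSDp W p :=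
  RowC1.bsdp (RowC1.skinnerThmC_of_mainConjectures_of_mazur hSU hA hGr hJs hJn hGS hM hmod hpar hGZK)
    hmod hGZK h

/-! ### §3. The good-ordinary half of row C1 one level lower: bsd.S30 at the pair from four named
facts (Literature-side `SkinnerUrban2014.padicValRat_bsd_rank_zero_of_mainConjecture_of_mazur`) -/

/-- **Row C1, good ordinary branch, as the `p`-part display**: for `W` of analytic rank `0` at a good
ordinary `p ≥ 3` with (irr) and (ram), the bsd.S30 conclusion
`ord_p(L(E,1)/Ω_E) = ord_p #Ш + ord_p ∏ c_ℓ − 2 ord_p #E(ℚ)_tors` holds granted FOUR named facts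
with printed proofs — Skinner–Urban 2014 Thm. 3.6.9 (`hSU`), Greenberg 1999 Thm. 4.1 (`hGr`),
Mazur 1978 Cor. 4.1 (`hM`), the Modularity Theorem (`hmod`, `hpar`) — and Gross–Zagier–Kolyvagin
(`hGZK`, for `Ш` finite at analytic rank `0`); this is S–U Thm. 3.6.11 (a) with its proof's inputs
named (`SkinnerUrban2014.padicValRat_bsd_rank_zero_of_mainConjecture_of_mazur`), specialised to the
pair and with (irr) + (ram) ⇒ surj supplied (`surj_of_irr_of_ram`).
[cite: SkinnerUrban2014, Thm. 3.6.11 (a) and its proof (p. 46)] [cite: GreenbergLNM1716, Thm. 4.1]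
[cite: Mazur1978, Cor. 4.1] -/
theorem RowC1.padicValRat_rankZero_goodOrd_of_mazur
    (hSU : ∀ (W : WeierstrassCurve ℚ) [W.IsElliptic] [W.IsGloballyMinimal] (p : ℕ) [Fact p.Prime]
      (κ : ZpExtension ℚ p) (γ : Field.absoluteGaloisGroup ℚ) (N : ℕ) [NeZero N]
      (f : CuspForm (Gamma0 N) 2),
      skinner_urban_main_conjecture W p (κ := κ) (γ := γ) (f := f))
    (hGr : greenberg_charValue_rankZero) (hM : mazur_not_dvd_maninConstant_of_odd)
    (hmod : hasEntireLFunction_rat) (hpar : nonempty_modularParametrizationData)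
    (hGZK : rank_eq_analyticRank_of_analyticRank_le_one)
    (hr0 : W.analyticRank = 0) (hp : 3 ≤ p) (hord : GoodOrd W p) (hirr : Irr W p) (hram : Ram W p) :
    ∃ q : ℚ, W.entireLFunction 1 / (W.realPeriodRat : ℂ) = (q : ℂ) ∧
      padicValRat p q = (padicValNat p W.shaOrder : ℤ) + padicValNat p W.tamagawaProduct -
        2 * padicValNat p W.torsionOrder := by
  have hL : W.entireLFunction 1 ≠ 0 := (W.analyticRank_eq_zero_iff_holds (hmod W)).mp hr0
  have hfin : Finite W.sha := (hGZK W (by rw [hr0]; exact zero_le_one)).2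
  exact SkinnerUrban2014.padicValRat_bsd_rank_zero_of_mainConjecture_of_mazur hpar hSU hGr hM W p hp
    hord.1 hord.2 hirr hram hL (surj_of_irr_of_ram W p hirr hram) hfin

end Curve

end Summit.BirchSwinnertonDyer.Rank1Residual

end
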